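import Summits.RiemannHypothesis.RiemannHypothesis.Theorems.WeilCombCombShapePositivityMertensAll
import Summits.RiemannHypothesis.RiemannHypothesis.Theorems.WeilCombCombShapePositivityMertensLowerKernel
import Literature.NumberTheory.LFunctions.RosserSchoenfeldEq321Tabulated
import HarnessLib

/-!
# The Mertens remainder from BELOW: `−9/100 ≤ E₁(y)` for all `y ≥ 20`, hence the two-sided
# `|Σ_{n ≤ y} Λ(n)/n − log y + γ| ≤ 9/100` for every real `y ≥ 20` (STUB-PLAN `stub_windowCore`, Phase A, two-sided form)

Crux `WeilComb.CombShapePositivity` (item stmt-RiemannHypothesis-11229), line `Sketch`, STUB-PLAN `stub_windowCore`: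
the cross term B5 and the coercivity B7 consume `|E₁(M/m)|` two-sidedly ("`|E₁| ≤ 0.09` for `M/m ≥ 20`", plan §1.7).
The upper side is `WeilCombMertensAll.sum_vonMangoldt_div_le_of_twenty_le`; this file proves the LOWER side,
hypothesis-free:

* `[20, 10⁴)` — the kernel run of `…MertensLowerKernel` (`stub_mertensLowerSmall`);
* `[10⁴, 4599989)` — Rosser–Schoenfeld's (3.21) as certified in the tree (`RosserSchoenfeld1962_eq_3_21_tabulated`,
  `S(x) > log x + E − 1/(2 log x)`) plus the prime-power tail `T(x) = (−γ − E) − Σ_{n ≤ x, n ∉ ℙ} Λ(n)/n ≤ 0.012` for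
  `x ≥ 10⁴`, obtained WITHOUT any analytic tail estimate: the partial sum is monotone in `x`, at `x = 10⁴` it is
  `≥ 0.7437` by the kernel (`primePowerSum_ge`), and `−γ − E ≤ 1.332901 − 0.57721558`
  (`WeilCombMertensMidrange.rosserSchoenfeldE_ge`, `eulerMascheroniConstant_gt_d8`); so `E₁(x) > −1/(2 log x) − 0.012 ≥ −0.067`;
* `[442439, ∞)` — `|E₁| ≤ 0.0185` (`WeilCombMertensE1.abs_mertensRemainder_le_of_ge`).

Results: `mertensRemainder_ge_of_twenty_le` (`−9/100 ≤ E₁(y)`, `y ≥ 20`; the true minimum is `−0.0834` at `y → 23⁻`) and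
the registered stub `stub_mertensTwoSided` (`|E₁(y)| ≤ 9/100` for every real `y ≥ 20`).
-/

noncomputable section

-- the sub-problem path RiemannHypothesis/RiemannHypothesis duplicates a namespace (D-0017)
set_option linter.dupNamespace false

open Finset ArithmeticFunction

namespace Summit.RiemannHypothesis.RiemannHypothesis.Theorems.WeilCombMertensLower

open Literature.NumberTheory.LFunctions
open MertensFirstChain (ELO)
open WeilCombMertensLowerKernel (stub_mertensLowerSmall primePowerSum_ge npTerm npTerm_nonneg)

/-! ### The prime-power tail beyond `10⁴` -/

/-- **The prime-power tail is at most `0.012` beyond `10⁴`**: for every natural `N ≥ 10⁴`,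
`(−γ − E) − Σ_{1 < k ≤ N, k ∉ ℙ} Λ(k)/k ≤ 0.012` (monotonicity in `N`, the kernel value at `10⁴`, `−E ≤ 1.332901`,
`γ > 0.57721558`). [cite: RosserSchoenfeld1962, (2.8) and (2.11)] -/
theorem primePower_tail_le {N : ℕ} (hN : 10000 ≤ N) :
    -Real.eulerMascheroniConstant - rosserSchoenfeldE - ∑ k ∈ Finset.Ioc 1 N, npTerm k ≤ 0.012 := by
  have hmono : ∑ k ∈ Finset.Ioc 1 10000, npTerm k ≤ ∑ k ∈ Finset.Ioc 1 N, npTerm k :=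
    Finset.sum_le_sum_of_subset_of_nonneg (Finset.Ioc_subset_Ioc_right hN) fun k _ _ ↦ npTerm_nonneg k
  have hpp : (0.7437 : ℝ) ≤ ∑ k ∈ Finset.Ioc 1 10000, npTerm k := by
    have h := primePowerSum_ge
    unfold WeilCombMertensLowerKernel.npTerm
    exact h
  have hE := WeilCombMertensMidrange.rosserSchoenfeldE_ge
  have hγ := Literature.Analysis.SpecialFunctions.Real.eulerMascheroniConstant_gt_d8
  have hELO : (ELO : ℝ) / 2 ^ 80 ≤ 1.332901 := by
    rw [div_le_iff₀ (by positivity)]; norm_num [ELO]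
  have : -(ELO : ℝ) / 2 ^ 80 = -((ELO : ℝ) / 2 ^ 80) := by ring
  rw [this] at hE
  linarith

/-- The split `Σ_{n ≤ N} Λ(n)/n = Σ_{p ≤ N} (log p)/p + Σ_{1 < k ≤ N} npTerm k` (`N ≥ 1`). [folklore] -/
theorem sum_vonMangoldt_div_eq_primes_add_npTerm {N : ℕ} (hN : 1 ≤ N) :
    ∑ n ∈ Finset.Icc 1 N, (Λ n : ℝ) / n =
      (∑ p ∈ Nat.primesLE N, Real.log p / p) + ∑ k ∈ Finset.Ioc 1 N, npTerm k := by
  rw [WeilCombMertensMidrange.sum_vonMangoldt_div_eq_primes_add_nonPrimes]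
  congr 1
  unfold npTerm
  rw [← Finset.sum_Ioc_consecutive _ (Nat.zero_le 1) hN, Nat.Ioc_succ_singleton, Finset.sum_singleton]
  simp [Nat.not_prime_one]

/-- `log 10⁴ ≥ 9.2` (`e^{9.2} = e⁹ e^{0.2} ≤ 9898 < 10⁴`). [folklore] -/
theorem log_ten_pow_four_ge : (9.2 : ℝ) ≤ Real.log 10000 := by
  rw [Real.le_log_iff_exp_le (by norm_num)]
  have h1 : Real.exp 1 < 2.7182818286 := Real.exp_one_lt_d9
  have h02 : Real.exp (0.2 : ℝ) ≤ 1.2215 := by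
    have := Real.exp_bound (x := (0.2 : ℝ)) (by norm_num) (n := 4) (by norm_num)
    simp only [Finset.sum_range_succ, Finset.sum_range_zero, Nat.factorial] at this
    have habs := abs_sub_le_iff.1 this
    norm_num at habs
    linarith [habs.1]
  have he : Real.exp (9.2 : ℝ) = Real.exp 1 ^ 9 * Real.exp 0.2 := by
    rw [← Real.exp_nat_mul, ← Real.exp_add]; norm_num
  rw [he]
  have h9 : Real.exp 1 ^ 9 ≤ (2.7182818286 : ℝ) ^ 9 := pow_le_pow_left₀ (Real.exp_pos 1).le h1.le 9
  calc Real.exp 1 ^ 9 * Real.exp 0.2 ≤ (2.7182818286 : ℝ) ^ 9 * 1.2215 :=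
        mul_le_mul h9 h02 (Real.exp_pos _).le (by positivity)
    _ ≤ 10000 := by norm_num

/-- **The mid range from below**: for `10⁴ ≤ x < 4599989`, `E₁(x) > −1/(2 log x) − 0.012 ≥ −0.067`.
[cite: RosserSchoenfeld1962, Thm. 6 (3.21)] -/
theorem mertensRemainder_gt_mid {x : ℝ} (hx : 10000 ≤ x) (hx' : x < 4599989) :
    -(0.067 : ℝ) < ∑ n ∈ Finset.Icc 1 ⌊x⌋₊, (Λ n : ℝ) / n - Real.log x + Real.eulerMascheroniConstant := by
  have hx1 : 1 < x := by linarith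
  have hN : 10000 ≤ ⌊x⌋₊ := Nat.le_floor (by exact_mod_cast hx)
  have h321 := RosserSchoenfeld1962_eq_3_21_tabulated hx1 hx'
  rw [sum_vonMangoldt_div_eq_primes_add_npTerm (N := ⌊x⌋₊) (by omega)]
  have htail := primePower_tail_le hN
  have hlog : (9.2 : ℝ) ≤ Real.log x := log_ten_pow_four_ge.trans (Real.log_le_log (by norm_num) hx)
  have hinv : 1 / (2 * Real.log x) ≤ 1 / (2 * 9.2) :=
    div_le_div_of_nonneg_left zero_le_one (by norm_num) (by linarith)
  have hnum : (1 : ℝ) / (2 * 9.2) ≤ 0.0544 := by norm_num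
  linarith

/-! ### The lower bound on `[20, ∞)` and the two-sided bound -/

/-- **`−9/100 ≤ Σ_{n ≤ y} Λ(n)/n − log y + γ` for every real `y ≥ 20`** (kernel on `[20, 10⁴)`, (3.21) + prime-power tail
on `[10⁴, 442439]`, the zeros beyond). The true minimum is `−0.0834` (`y → 23⁻`). [cite: RosserSchoenfeld1962, Thm. 6 and Lemma 7] -/
theorem mertensRemainder_ge_of_twenty_le {y : ℝ} (hy : 20 ≤ y) :
    -(9 / 100 : ℝ) ≤ ∑ n ∈ Finset.Icc 1 ⌊y⌋₊, (Λ n : ℝ) / n - Real.log y + Real.eulerMascheroniConstant := by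
  have hy0 : 0 ≤ y := by linarith
  rcases lt_or_ge y 10000 with h1 | h1
  · -- kernel range
    have hN20 : 20 ≤ ⌊y⌋₊ := Nat.le_floor (by exact_mod_cast hy)
    have hN : ⌊y⌋₊ ≤ 9999 := by
      have : ⌊y⌋₊ < 10000 := (Nat.floor_lt hy0).2 (by exact_mod_cast h1)
      omega
    have h := stub_mertensLowerSmall ⌊y⌋₊ hN20 hN
    have hlog : Real.log y ≤ Real.log ((⌊y⌋₊ : ℝ) + 1) :=
      Real.log_le_log (by linarith) (Nat.lt_floor_add_one y).le
    linarith
  rcases le_or_gt y 442439 with h2 | h2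
  · have h := mertensRemainder_gt_mid h1 (by linarith)
    linarith
  · have h := WeilCombMertensE1.abs_mertensRemainder_le_of_ge h2.le
    have h' := (abs_le.1 h).1
    linarith

/-- **Stub `stub_mertensTwoSided` (registered on crux stmt-RiemannHypothesis-11229): the two-sided M-uniform Mertens
remainder** `|Σ_{n ≤ y} Λ(n)/n − log y + γ| ≤ 9/100` for every real `y ≥ 20` (upper side `WeilCombMertensAll`,
lower side this file). [cite: RosserSchoenfeld1962, Thm. 6 and Lemma 7] -/
theorem stub_mertensTwoSided : ∀ y : ℝ, 20 ≤ y →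
    |∑ n ∈ Finset.Icc 1 ⌊y⌋₊, (ArithmeticFunction.vonMangoldt n : ℝ) / n - Real.log y +
      Real.eulerMascheroniConstant| ≤ 9 / 100 := by
  intro y hy
  rw [abs_le]
  refine ⟨by linarith [mertensRemainder_ge_of_twenty_le hy], ?_⟩
  have := WeilCombMertensAll.sum_vonMangoldt_div_le_of_twenty_le hy
  linarith

end Summit.RiemannHypothesis.RiemannHypothesis.Theorems.WeilCombMertensLower

end
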